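import Summits.Ventures.CertifiedArithmetic.LowPrec.Round
import Literature.ComputerArithmetic.JeannerodRump2018.OptimalBound
import Mathlib.Data.Int.Log

/-!
# The rounding bridge: `roundNE` is a Jeannerod–Rump round-to-nearest map (ties to even)

HONEST FRAMING (venture CertifiedArithmetic / cell `pub-lowprec`): certified error envelopes and
provably optimal rounding/accumulation schemes for low-precision formats under stated cost models;
every table by two implementations; no hardware or vendor claims.

`JRBridge.lean` showed that the finite VALUES of a format `φ` are exactly the Jeannerod–Rump
floats `F(p, emin)` (`IsFloat (m+1) (qexp φ)`: `M·2^e`, `|M| < 2^(m+1)`, `e ≥ qexp φ`, no upper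
exponent bound) of magnitude `≤ maxRat φ`, and left open the ROUNDING half: the Literature tree's
theorems ([JeannerodRump2018] Thm 4.1, [LangeRump2018] Props 1/3/14, Thm 10, and the opt seat's
tree-polynomial law `LowPrec/OptTreePoly`, `OptTreeWitness`, `OptTreeMixed`) quantify over
`fl : ℚ → ℚ` with `IsRoundNearest p emin fl` — a round-to-nearest map on ALL of `ℚ` into the
unbounded-above model — while the venture's executable `roundNE φ` saturates at `±maxRat`.

This file closes the gap.  `Format.flJR φ : ℚ → ℚ` is round-to-nearest-EVEN into `F(m+1, qexp φ)`
(grid exponent `gridExp x = max (qexp) (⌊log₂|x|⌋ - m)`, integer rounding by the Literature's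
`rneInt`), and we PROVE
* `Format.isRoundNearest_flJR`: `IsRoundNearest (m+1) (qexp φ) (flJR φ)` (values in `F`,
  nearest among ALL of `F`, including floats above `maxRat`);
* `Format.flJR_eq_roundNE`: `flJR φ x = (roundNE φ x).toRat` whenever `|x| ≤ maxRat φ` — the
  saturating executable rounding and the model rounding agree on the whole finite range (same
  grid exponent: `gridExp_eq_shift`; no clamping below `maxScaled`);
and the companion `RoundNearestJRTransfer.lean` adds ties-to-even at the binade midpoints (the opt
seat's `TiesEvenAtPow`) and the transfer of tree evaluations (`eval (flα α) = eval (flJR α)` under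
`TreeInRange α`), so that every Literature / opt statement over `IsRoundNearest` applies verbatim to
the bit-level formats under the cell's standing "nodes in range" hypothesis.

Placement: venture development; dot-notation extensions of the Literature structures `Format` /
`MiniFloat` (CONVENTIONS §2).
-/

namespace Literature.ComputerArithmetic.FloatingPoint

open Literature.ComputerArithmetic.JeannerodRump2018

/-! ### Two facts about `rneInt` -/

/-- Below the midpoint `rneInt` rounds down: `rneInt (N + t) = N` for `0 ≤ t < 1/2`. [folklore] -/
theorem rneInt_intCast_add_of_lt_half (N : ℤ) {t : ℚ} (h0 : 0 ≤ t) (h : t < 1 / 2) :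
    rneInt ((N : ℚ) + t) = N := by
  have hfl : ⌊(N : ℚ) + t⌋ = N := by
    rw [Int.floor_eq_iff]; constructor <;> linarith
  unfold rneInt
  rw [hfl, if_pos (by linarith)]

/-- At the midpoint `rneInt` picks the even integer: `rneInt (N + 1/2) = N` for even `N`.
[cite: IEEE7542019, §4.3.1] -/
theorem rneInt_intCast_add_half_of_even {N : ℤ} (hN : 2 ∣ N) :
    rneInt ((N : ℚ) + 1 / 2) = N := by
  have hfl : ⌊(N : ℚ) + 1 / 2⌋ = N := by
    rw [Int.floor_eq_iff]; constructor <;> linarith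
  unfold rneInt
  rw [hfl, if_neg (by linarith), if_neg (by linarith), if_pos hN]

/-- `rneInt 0 = 0`. [folklore] -/
theorem rneInt_zero : rneInt 0 = 0 := by
  simpa using rneInt_intCast_add_of_lt_half 0 le_rfl (by norm_num : (0 : ℚ) < 1 / 2)

namespace Format

variable (φ : Format)

/-! ### The model rounding `flJR` -/

/-- Grid exponent of `x` in `F(m+1, qexp φ)`: the spacing of the floats around `|x|` is
`2 ^ gridExp x` with `gridExp x = max (qexp φ) (⌊log₂ |x|⌋ - m)` (the quantum exponent in the
gradual-underflow range, else the exponent of the unit in the last place of `|x|`'s binade; no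
upper cap — the model has no overflow). [cite: JeannerodRump2018, §1] -/
def gridExp (x : ℚ) : ℤ := max φ.qexp (Int.log 2 |x| - φ.manBits)

/-- Magnitude of the model rounding: `|x|` rounded to the nearest multiple of `2 ^ gridExp x`,
ties to the even multiple. [cite: IEEE7542019, §4.3.1] -/
def flJRMag (x : ℚ) : ℚ := (rneInt (|x| / (2 : ℚ) ^ φ.gridExp x) : ℚ) * (2 : ℚ) ^ φ.gridExp x

/-- ROUND-TO-NEAREST-EVEN INTO THE JEANNEROD–RUMP MODEL `F(m+1, qexp φ)` (precision and
gradual underflow of `φ`, NO overflow): the extension of the format's `roundNE` to a nearest map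
on all of `ℚ` that the Literature statements quantify over. [cite: JeannerodRump2018, §1 eq. (1.1)] -/
def flJR (x : ℚ) : ℚ := if x < 0 then -φ.flJRMag x else φ.flJRMag x

variable {φ}

/-- `qexp ≤ gridExp x`. [folklore] -/
theorem qexp_le_gridExp (x : ℚ) : φ.qexp ≤ φ.gridExp x := le_max_left _ _

/-- `⌊log₂|x|⌋ - m ≤ gridExp x`. [folklore] -/
theorem log_sub_le_gridExp (x : ℚ) : Int.log 2 |x| - φ.manBits ≤ φ.gridExp x := le_max_right _ _

/-- `gridExp` is even. [folklore] -/
@[simp] theorem gridExp_neg (x : ℚ) : φ.gridExp (-x) = φ.gridExp x := by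
  unfold gridExp; rw [abs_neg]

/-- `flJRMag` is even. [folklore] -/
@[simp] theorem flJRMag_neg (x : ℚ) : φ.flJRMag (-x) = φ.flJRMag x := by
  unfold flJRMag; rw [gridExp_neg, abs_neg]

/-- `flJRMag 0 = 0`. [folklore] -/
@[simp] theorem flJRMag_zero : φ.flJRMag 0 = 0 := by
  unfold flJRMag; simp [rneInt_zero]

/-- `flJR 0 = 0`. [folklore] -/
@[simp] theorem flJR_zero : φ.flJR 0 = 0 := by
  unfold flJR; simp

/-- For `x ≥ 0`, `flJR x = flJRMag x`. [folklore] -/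
theorem flJR_of_nonneg {x : ℚ} (hx : 0 ≤ x) : φ.flJR x = φ.flJRMag x := by
  unfold flJR; rw [if_neg (not_lt.mpr hx)]

/-- `flJR` is odd: `flJR (-x) = - flJR x`. [folklore] -/
theorem flJR_neg (x : ℚ) : φ.flJR (-x) = -φ.flJR x := by
  rcases lt_trichotomy x 0 with h | rfl | h
  · unfold flJR; rw [if_neg (by linarith), if_pos h, flJRMag_neg, neg_neg]
  · simp
  · unfold flJR; rw [if_pos (by linarith), if_neg (by linarith), flJRMag_neg]

/-- The power `2 ^ gridExp x` is positive. [folklore] -/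
theorem two_zpow_gridExp_pos (x : ℚ) : (0 : ℚ) < (2 : ℚ) ^ φ.gridExp x := zpow_pos (by norm_num) _

/-- `|x| < 2 ^ (gridExp x + m + 1)`: the scaled magnitude is below `2^(m+1)`. [folklore] -/
theorem abs_lt_two_zpow_gridExp (x : ℚ) :
    |x| < (2 : ℚ) ^ (φ.gridExp x + ((φ.manBits + 1 : ℕ) : ℤ)) := by
  rcases eq_or_ne x 0 with rfl | hx
  · rw [abs_zero]; exact zpow_pos (by norm_num) _
  · have h1 : |x| < ((2 : ℕ) : ℚ) ^ (Int.log 2 |x| + 1) := Int.lt_zpow_succ_log_self (by norm_num) |x|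
    have h2 : Int.log 2 |x| + 1 ≤ φ.gridExp x + ((φ.manBits + 1 : ℕ) : ℤ) := by
      have := log_sub_le_gridExp (φ := φ) x; push_cast; omega
    calc |x| < (2 : ℚ) ^ (Int.log 2 |x| + 1) := by exact_mod_cast h1
      _ ≤ (2 : ℚ) ^ (φ.gridExp x + ((φ.manBits + 1 : ℕ) : ℤ)) := zpow_le_zpow_right₀ (by norm_num) h2

/-- The scaled magnitude `|x| / 2^(gridExp x)` lies in `[0, 2^(m+1))`. [folklore] -/
theorem scaled_gridExp_lt (x : ℚ) : |x| / (2 : ℚ) ^ φ.gridExp x < (2 : ℚ) ^ (φ.manBits + 1) := by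
  rw [div_lt_iff₀ (two_zpow_gridExp_pos x), ← zpow_natCast, ← zpow_add₀ (by norm_num : (2 : ℚ) ≠ 0),
    add_comm]
  exact abs_lt_two_zpow_gridExp x

/-- Dichotomy for `x ≠ 0`: either the grid is the quantum grid (`gridExp x = qexp`), or `|x|` is
normalised on its grid: `2 ^ (gridExp x + m) ≤ |x|`. [folklore] -/
theorem gridExp_eq_qexp_or {x : ℚ} (hx : x ≠ 0) :
    φ.gridExp x = φ.qexp ∨ (2 : ℚ) ^ (φ.gridExp x + φ.manBits) ≤ |x| := by
  unfold gridExp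
  rcases le_or_gt (Int.log 2 |x| - φ.manBits) φ.qexp with h | h
  · exact Or.inl (max_eq_left h)
  · right
    rw [max_eq_right h.le, sub_add_cancel]
    have := Int.zpow_log_le_self (b := 2) (by norm_num) (abs_pos.mpr hx)
    exact_mod_cast this

/-! ### `flJR` maps into `F(m+1, qexp)` -/

/-- The RNE quotient `rneInt (|x| / 2^(gridExp x))` lies in `[0, 2^(m+1)]`. [folklore] -/
theorem rneInt_scaled_bounds (x : ℚ) :
    0 ≤ rneInt (|x| / (2 : ℚ) ^ φ.gridExp x) ∧
      rneInt (|x| / (2 : ℚ) ^ φ.gridExp x) ≤ 2 ^ (φ.manBits + 1) := by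
  refine ⟨rneInt_nonneg (div_nonneg (abs_nonneg x) (two_zpow_gridExp_pos x).le), ?_⟩
  have h := (scaled_gridExp_lt (φ := φ) x).le
  have : |x| / (2 : ℚ) ^ φ.gridExp x ≤ ((2 ^ (φ.manBits + 1) : ℤ) : ℚ) := by push_cast; exact h
  exact rneInt_le_of_le this

/-- `flJRMag x ∈ F(m+1, qexp)` (with a carry into the next binade when the quotient is `2^(m+1)`).
[folklore] -/
theorem isFloat_flJRMag (x : ℚ) : IsFloat (φ.manBits + 1) φ.qexp (φ.flJRMag x) := by
  obtain ⟨h0, hle⟩ := rneInt_scaled_bounds (φ := φ) x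
  have he := qexp_le_gridExp (φ := φ) x
  unfold flJRMag
  rcases lt_or_eq_of_le hle with hlt | heq
  · exact ⟨rneInt (|x| / (2 : ℚ) ^ φ.gridExp x), φ.gridExp x, by rwa [abs_of_nonneg h0], he, rfl⟩
  · refine ⟨2 ^ φ.manBits, φ.gridExp x + 1, ?_, by omega, ?_⟩
    · rw [abs_of_nonneg (by positivity)]
      exact pow_lt_pow_right₀ (by norm_num) (Nat.lt_succ_self _)
    · rw [heq, zpow_add₀ (by norm_num : (2 : ℚ) ≠ 0), zpow_one]; push_cast; ring

/-- `flJR x ∈ F(m+1, qexp)`. [cite: JeannerodRump2018, §1] -/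
theorem isFloat_flJR (x : ℚ) : IsFloat (φ.manBits + 1) φ.qexp (φ.flJR x) := by
  unfold flJR
  split
  · exact (isFloat_flJRMag x).neg
  · exact isFloat_flJRMag x

/-! ### `flJR` is nearest -/

/-- For `x ≥ 0`, `flJRMag x` is at least as close to `x` as any float of `F(m+1, qexp)`
(floats on a finer grid are below `x`'s binade; floats on the same or a coarser grid are
multiples of the spacing). [folklore] -/
theorem abs_sub_flJRMag_le {x : ℚ} (hx : 0 ≤ x) {f : ℚ} (hf : IsFloat (φ.manBits + 1) φ.qexp f) :
    |x - φ.flJRMag x| ≤ |x - f| := by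
  rcases hx.eq_or_lt with rfl | hxpos
  · rw [flJRMag_zero, sub_zero, abs_zero]; exact abs_nonneg _
  obtain ⟨M, e', hM, he', rfl⟩ := hf
  have habs : |x| = x := abs_of_pos hxpos
  have hc := two_zpow_gridExp_pos (φ := φ) x
  set e := φ.gridExp x with he_def
  rcases le_or_gt e e' with hle | hlt
  · -- `f` is a multiple of the spacing `2^e`
    obtain ⟨d, hd⟩ := Int.eq_ofNat_of_zero_le (sub_nonneg.mpr hle)
    have hf : (M : ℚ) * (2 : ℚ) ^ e' = ((M * 2 ^ d : ℤ) : ℚ) * (2 : ℚ) ^ e := by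
      rw [show e' = e + (d : ℤ) by omega, zpow_add₀ (by norm_num : (2 : ℚ) ≠ 0), zpow_natCast]
      push_cast; ring
    rw [hf]
    unfold flJRMag
    rw [← he_def, habs]
    exact abs_sub_rneInt_mul_le x hc (M * 2 ^ d)
  · -- `f` lives on a finer grid, hence below `2^(e+m) ≤ x`
    rcases gridExp_eq_qexp_or (φ := φ) hxpos.ne' with hq | hnorm
    · exfalso; rw [← he_def] at hq; omega
    rw [← he_def, habs] at hnorm
    have hfabs : |(M : ℚ) * (2 : ℚ) ^ e'| < (2 : ℚ) ^ (e + φ.manBits) := by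
      rw [abs_mul, abs_of_pos (zpow_pos (by norm_num : (0 : ℚ) < 2) e')]
      have hM' : |(M : ℚ)| < (2 : ℚ) ^ ((φ.manBits + 1 : ℕ) : ℤ) := by
        rw [zpow_natCast]; exact_mod_cast hM
      calc |(M : ℚ)| * (2 : ℚ) ^ e' < (2 : ℚ) ^ ((φ.manBits + 1 : ℕ) : ℤ) * (2 : ℚ) ^ e' :=
            mul_lt_mul_of_pos_right hM' (zpow_pos (by norm_num) _)
        _ = (2 : ℚ) ^ (((φ.manBits + 1 : ℕ) : ℤ) + e') := (zpow_add₀ (by norm_num) _ _).symm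
        _ ≤ (2 : ℚ) ^ (e + φ.manBits) := zpow_le_zpow_right₀ (by norm_num) (by push_cast; omega)
    have hflow : |x - φ.flJRMag x| ≤ x - (2 : ℚ) ^ (e + φ.manBits) := by
      have h1 := abs_sub_rneInt_mul_le x hc (2 ^ φ.manBits)
      have e1 : ((2 ^ φ.manBits : ℤ) : ℚ) * (2 : ℚ) ^ e = (2 : ℚ) ^ (e + φ.manBits) := by
        push_cast; rw [zpow_add₀ (by norm_num : (2 : ℚ) ≠ 0), zpow_natCast]; ring
      rw [e1, abs_of_nonneg (by linarith : 0 ≤ x - (2 : ℚ) ^ (e + φ.manBits))] at h1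
      unfold flJRMag; rw [← he_def, habs]; exact h1
    have hfle : (M : ℚ) * (2 : ℚ) ^ e' < (2 : ℚ) ^ (e + φ.manBits) := lt_of_le_of_lt (le_abs_self _) hfabs
    calc |x - φ.flJRMag x| ≤ x - (2 : ℚ) ^ (e + φ.manBits) := hflow
      _ ≤ x - (M : ℚ) * (2 : ℚ) ^ e' := by linarith
      _ ≤ |x - (M : ℚ) * (2 : ℚ) ^ e'| := le_abs_self _

/-- NEAREST: `flJR x` is at least as close to `x` as any float of `F(m+1, qexp)` — floats of any
magnitude, above `maxRat` included. [cite: JeannerodRump2018, §1 eq. (1.1)] -/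
theorem abs_sub_flJR_le (x : ℚ) {f : ℚ} (hf : IsFloat (φ.manBits + 1) φ.qexp f) :
    |x - φ.flJR x| ≤ |x - f| := by
  rcases le_or_gt 0 x with hx | hx
  · rw [flJR_of_nonneg hx]; exact abs_sub_flJRMag_le hx hf
  · have h := abs_sub_flJRMag_le (φ := φ) (x := -x) (by linarith) hf.neg
    rw [flJRMag_neg, show -x - φ.flJRMag x = -(x - φ.flJR x) by
      unfold flJR; rw [if_pos hx]; ring, abs_neg, show -x - -f = -(x - f) by ring, abs_neg] at h
    exact h

/-- **`flJR φ` IS A ROUND-TO-NEAREST MAP INTO `F(m+1, qexp φ)`** in the sense of the Literature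
(`IsRoundNearest`): every Literature / opt theorem stated over `IsRoundNearest p emin fl` applies
to it. [cite: JeannerodRump2018, §1 eq. (1.1)] -/
theorem isRoundNearest_flJR (φ : Format) : IsRoundNearest (φ.manBits + 1) φ.qexp φ.flJR :=
  fun t => ⟨isFloat_flJR t, fun _ hf => abs_sub_flJR_le t hf⟩

/-! ### Agreement with the executable `roundNE` on the finite range -/

/-- No clamping below the top: for `0 ≤ r ≤ maxScaled` the unclamped grid rounding stays within
range (`maxScaled` is a grid point above `r`). Local copy of `ScaleInvariance`'s
`rneMult_le_maxScaled_of_le` (kept private to avoid importing the envelope files here). [folklore] -/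
private theorem rneMult_le_maxScaled_of_le_aux {r : ℚ} (hr : 0 ≤ r) (hle : r ≤ φ.maxScaled) :
    φ.rneMult r ≤ φ.maxScaled := by
  have hc : (0 : ℚ) < 2 ^ φ.shift ⌊r⌋.toNat := by positivity
  have hdv : 2 ^ φ.shift ⌊r⌋.toNat ∣ φ.maxScaled := by
    rcases shift_floor_dichotomy (φ := φ) hr with hs | hfloor
    · rw [hs]; exact one_dvd _
    · exact pow_dvd_of_representable (MiniFloat.representable_maxScaled φ)
        (by exact_mod_cast le_trans hfloor hle)
  obtain ⟨M, hM⟩ := hdv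
  have hrM : r / 2 ^ φ.shift ⌊r⌋.toNat ≤ ((M : ℕ) : ℤ) := by
    rw [div_le_iff₀ hc]; push_cast
    calc r ≤ φ.maxScaled := hle
      _ = (M : ℚ) * 2 ^ φ.shift ⌊r⌋.toNat := by rw [hM]; push_cast; ring
  have hq := rneInt_le_of_le hrM
  unfold rneMult; rw [hM, mul_comm (2 ^ _) M]
  apply Nat.mul_le_mul_right; omega

/-- THE SAME GRID: for `0 < |x| ≤ maxRat` the model's grid exponent is the format's binade shift
above the quantum, `gridExp x = qexp + shift ⌊|x| / quantum⌋`. [folklore] -/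
theorem gridExp_eq_shift {x : ℚ} (hx : x ≠ 0) (h : |x| ≤ φ.maxRat) :
    φ.gridExp x = φ.qexp + ((φ.shift ⌊|x| / φ.quantum⌋.toNat : ℕ) : ℤ) := by
  have hq := φ.quantum_pos
  have hxpos : 0 < |x| := abs_pos.mpr hx
  set r := |x| / φ.quantum with hr_def
  have hr : 0 ≤ r := div_nonneg (abs_nonneg x) hq.le
  set n := ⌊r⌋.toNat with hn_def
  have hnr : (n : ℚ) ≤ r := floor_toNat_le hr
  have hrn : r < (n : ℚ) + 1 := lt_floor_toNat_add_one r
  have hxr : |x| = r * φ.quantum := by rw [hr_def, div_mul_cancel₀ _ hq.ne']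
  have hquant : φ.quantum = (2 : ℚ) ^ φ.qexp := rfl
  have hnmax : n ≤ φ.maxScaled := by
    have : (n : ℚ) ≤ φ.maxScaled := le_trans hnr (by rw [hr_def, div_le_iff₀ hq]; exact h)
    exact_mod_cast this
  by_cases hsmall : n < 2 ^ φ.manBits
  · -- quantum grid: `|x| < 2^(qexp + m)`
    have hs : φ.shift n = 0 := shift_eq_zero_of_lt (by rw [pow_succ]; omega)
    rw [hs]
    have hlt : |x| < ((2 : ℕ) : ℚ) ^ (φ.qexp + φ.manBits) := by
      have hn1 : (n : ℚ) + 1 ≤ (2 : ℚ) ^ φ.manBits := by exact_mod_cast hsmall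
      calc |x| = r * φ.quantum := hxr
        _ < ((n : ℚ) + 1) * φ.quantum := mul_lt_mul_of_pos_right hrn hq
        _ ≤ (2 : ℚ) ^ φ.manBits * φ.quantum := mul_le_mul_of_nonneg_right hn1 hq.le
        _ = ((2 : ℕ) : ℚ) ^ (φ.qexp + φ.manBits) := by
            rw [hquant, Nat.cast_ofNat, zpow_add₀ (by norm_num : (2 : ℚ) ≠ 0), zpow_natCast]; ring
    have hlog := (Int.lt_zpow_iff_log_lt (b := 2) (by norm_num) hxpos).mp hlt
    unfold gridExp
    rw [max_eq_left (by omega)]; push_cast; ring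
  · -- binade with spacing `2^s`: `2^(qexp+m+s) ≤ |x| < 2^(qexp+m+s+1)`
    have hge : 2 ^ φ.manBits ≤ n := not_lt.mp hsmall
    set s := φ.shift n with hs_def
    have hlow : 2 ^ (φ.manBits + s) ≤ n := pow_shift_le hge
    have hup : n < 2 ^ (φ.manBits + 1 + s) := MiniFloat.lt_pow_shift_of_le_maxScaled hnmax hge
    have hlowQ : ((2 : ℕ) : ℚ) ^ (φ.qexp + φ.manBits + s) ≤ |x| := by
      have h1 : (2 : ℚ) ^ (φ.manBits + s) ≤ n := by exact_mod_cast hlow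
      calc ((2 : ℕ) : ℚ) ^ (φ.qexp + φ.manBits + s)
          = (2 : ℚ) ^ (φ.manBits + s) * φ.quantum := by
            rw [hquant, Nat.cast_ofNat, show φ.qexp + φ.manBits + s = ((φ.manBits + s : ℕ) : ℤ) + φ.qexp
              by push_cast; ring, zpow_add₀ (by norm_num : (2 : ℚ) ≠ 0), zpow_natCast]
        _ ≤ (n : ℚ) * φ.quantum := mul_le_mul_of_nonneg_right h1 hq.le
        _ ≤ r * φ.quantum := mul_le_mul_of_nonneg_right hnr hq.le
        _ = |x| := hxr.symm
    have hupQ : |x| < ((2 : ℕ) : ℚ) ^ (φ.qexp + φ.manBits + s + 1) := by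
      have hn1 : (n : ℚ) + 1 ≤ (2 : ℚ) ^ (φ.manBits + 1 + s) := by exact_mod_cast hup
      calc |x| = r * φ.quantum := hxr
        _ < ((n : ℚ) + 1) * φ.quantum := mul_lt_mul_of_pos_right hrn hq
        _ ≤ (2 : ℚ) ^ (φ.manBits + 1 + s) * φ.quantum := mul_le_mul_of_nonneg_right hn1 hq.le
        _ = ((2 : ℕ) : ℚ) ^ (φ.qexp + φ.manBits + s + 1) := by
            rw [hquant, Nat.cast_ofNat,
              show φ.qexp + φ.manBits + s + 1 = ((φ.manBits + 1 + s : ℕ) : ℤ) + φ.qexp by push_cast; ring,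
              zpow_add₀ (by norm_num : (2 : ℚ) ≠ 0), zpow_natCast]
    have hlog1 := (Int.zpow_le_iff_le_log (b := 2) (by norm_num) hxpos).mp hlowQ
    have hlog2 := (Int.lt_zpow_iff_log_lt (b := 2) (by norm_num) hxpos).mp hupQ
    have hlog : Int.log 2 |x| = φ.qexp + φ.manBits + s := by omega
    unfold gridExp
    rw [hlog, max_eq_right (by omega)]; ring

/-- On the finite range the model rounding has the format's magnitude:
`flJRMag x = rneMult (|x|/quantum) · quantum` for `0 < |x| ≤ maxRat`. [folklore] -/
theorem flJRMag_eq_rneMult_mul {x : ℚ} (hx : x ≠ 0) (h : |x| ≤ φ.maxRat) :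
    φ.flJRMag x = (φ.rneMult (|x| / φ.quantum) : ℚ) * φ.quantum := by
  have hq := φ.quantum_pos
  have he := gridExp_eq_shift hx h
  have hr := MiniFloat.scaledInput_nonneg (φ := φ) x
  have hpow : (2 : ℚ) ^ φ.gridExp x = 2 ^ φ.shift ⌊|x| / φ.quantum⌋.toNat * φ.quantum := by
    rw [he, zpow_add₀ (by norm_num : (2 : ℚ) ≠ 0), zpow_natCast]; unfold quantum; ring
  have hdiv : |x| / (2 : ℚ) ^ φ.gridExp x = |x| / φ.quantum / 2 ^ φ.shift ⌊|x| / φ.quantum⌋.toNat := by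
    rw [hpow, div_div, mul_comm]
  unfold flJRMag
  rw [rneMult_cast hr, hdiv, hpow]; ring

/-- **AGREEMENT ON THE FINITE RANGE**: for `|x| ≤ maxRat φ` the model rounding `flJR φ x` is the
value of the executable saturating `roundNE φ x`. [cite: IEEE7542019, §4.3.1] -/
theorem flJR_eq_roundNE {x : ℚ} (h : |x| ≤ φ.maxRat) : φ.flJR x = (roundNE φ x).toRat := by
  rcases eq_or_ne x 0 with rfl | hx
  · rw [flJR_zero, MiniFloat.toRat_roundNE_zero]
  have hq := φ.quantum_pos
  have hr := MiniFloat.scaledInput_nonneg (φ := φ) x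
  have hle : |x| / φ.quantum ≤ φ.maxScaled := by rw [div_le_iff₀ hq]; exact h
  rw [MiniFloat.toRat_roundNE, rneGrid_eq_min, min_eq_left (rneMult_le_maxScaled_of_le_aux hr hle)]
  unfold flJR
  rw [flJRMag_eq_rneMult_mul hx h]
  split <;> ring

end Format

end Literature.ComputerArithmetic.FloatingPoint
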